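import Summits.NavierStokesRegularity.FluidComputer.ClayBlowupPortrait
import Summits.NavierStokesRegularity.FluidComputer.DesignedBlowupClayBridge
import HarnessLib

/-!
# An AXISYMMETRIC tower realisation keeps its swirl bounded and reads its velocity floors off the
# POLOIDAL field (the E–C rows of g7/g8 in the tower interface's own vocabulary)

Cell `ns-blowup`, seat `ns-blowup-ecbridge-2` (g8; the E–C endpoint theory seat). LABEL: E–C typing
(KERNEL — no named fact). WHAT THIS IS NOT: not Navier–Stokes evidence — necessary conditions on the
TYPE `PalasekTowerClayBridge.Realisation ν R` (ecbridge-1's tower interface, p403760: a forced classical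
solution on `[0, T)` with Clay datum and force, velocity floors `c₁ Y_k ≤ ‖u(τ_k, x_k)‖` at readout
times `τ_k ∈ [0, T)` and points `‖x_k‖ ≤ radius`, ceilings and the Palasek clock); `PalasekStep2 R`
(the interface is inhabited) is the open conjecture of the route and is NOT asserted here. Companion
memo: `run/shared/lean/pub/ns-blowup/ecbridge2/ECBRIDGE-2-MEMO-7.md`.

## Content

A realisation IS a designed blow-up (`Realisation.toDesignedBlowup`, lean g4), so every row of the
E–C portrait applies to it. This file spells out the rows that constrain AXISYMMETRIC tower designs
(datum `u 0` axisymmetric, force `f t` axisymmetric for `0 ≤ t < T`):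

* `Realisation.swirl_bounded` — the azimuthal circulation `r u_θ` is bounded on `[0, T) × ℝ³`
  (g8, forced swirl maximum principle): although the rates force the per-structure circulation
  `Γ_k = N_k^{β−2}` to grow (`2 < 2b < β`, `TowerRates.two_b_lt_β`), NONE of that growth is azimuthal;
* `Realisation.abs_swirlVelocity_le` — `|u_θ(t, x)| ≤ C / r` off the axis;
* **`Realisation.floor_weighted_poloidal`** — at every readout `(τ_k, x_k)` of the floor
  `c₁ Y_k ≤ ‖u(τ_k, x_k)‖`: `r_k · c₁ Y_k ≤ r_k ‖ū(τ_k, x_k)‖ + C` (`r_k = cylRadius x_k`,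
  `ū = poloidalPart u`), with ONE constant `C` for all levels `k`;
* **`Realisation.floor_near_axis_or_poloidal`** — the dichotomy every level obeys: EITHER the readout
  point lies within `2C / (c₁ Y_k)` of the symmetry axis (`r_k c₁ Y_k ≤ 2C`), OR at least half the floor
  is poloidal (`c₁ Y_k / 2 ≤ ‖ū(τ_k, x_k)‖`);
* `Realisation.singularSlice_subset_axis`, `Realisation.dissipation_concentration` — the g7/g8 rows
  (singular points of the final slice on the axis; dissipation parabolic density `≥ ε(ν)` there) by name
  on the interface.

References: S. Palasek, arXiv:2605.13827 §4 [cite: Palasek2026ElementaryModel, §4]; G. Koch,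
N. Nadirashvili, G. Seregin, V. Šverák, Acta Math. 203 (2009), (1.8)–(1.9)
[cite: KochNadirashviliSereginSverak2009, §1 (1.8)–(1.9)]; G. Seregin, V. Šverák, Comm. PDE 34 (2009),
§1 (1.2) [cite: SereginSverak2009, §1 (1.2)]; C. L. Fefferman, Clay problem description, (C)
[cite: FeffermanClay2006, (C)].
-/

noncomputable section

namespace Summit.NavierStokesRegularity.FluidComputer

open Set MeasureTheory Filter Topology Function Metric
open scoped ENNReal ContDiff NNReal
open Literature.Analysis.FluidPDE
open Summit.NavierStokesRegularity.NavierStokesRegularity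

namespace PalasekTowerClayBridge.Realisation

variable {ν : ℝ} {R : TowerRates} (W : Realisation ν R)

/-- **The swirl of an axisymmetric tower realisation is bounded up to the blow-up time** (`ν > 0`;
datum and force axisymmetric on `[0, T)`): `|r u_θ(t, x)| ≤ C` on `[0, T) × ℝ³` — g8's
`DesignedBlowup.swirl_bounded` on `toDesignedBlowup`. [cite: KochNadirashviliSereginSverak2009, §1 (1.8)–(1.9)] -/
theorem swirl_bounded (hν : 0 < ν) (h0A : IsAxisymmetric (W.u 0))
    (hfA : ∀ t ∈ Ico 0 W.T, IsAxisymmetric (W.f t)) :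
    ∃ C : ℝ, 0 ≤ C ∧ ∀ t ∈ Ico 0 W.T, ∀ x, |swirl (W.u t) x| ≤ C :=
  W.toDesignedBlowup.swirl_bounded hν h0A hfA

/-- **`|u_θ| ≤ C / r` for an axisymmetric tower realisation** (`ν > 0`).
[cite: KochNadirashviliSereginSverak2009, §1 (1.9) and Thm. 6.1] -/
theorem abs_swirlVelocity_le (hν : 0 < ν) (h0A : IsAxisymmetric (W.u 0))
    (hfA : ∀ t ∈ Ico 0 W.T, IsAxisymmetric (W.f t)) :
    ∃ C : ℝ, 0 ≤ C ∧ ∀ t ∈ Ico 0 W.T, ∀ x : EuclideanSpace ℝ (Fin 3), cylRadius x ≠ 0 →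
      |swirlVelocity (W.u t) x| ≤ C / cylRadius x :=
  W.toDesignedBlowup.abs_swirlVelocity_le hν h0A hfA

/-- **THE FLOORS OF AN AXISYMMETRIC TOWER ARE POLOIDAL UP TO `O(1)`** (`ν > 0`; datum and force
axisymmetric): there is ONE constant `C ≥ 0` such that at every level `k` the readout point `x_k` of the
floor `c₁ Y_k ≤ ‖u(τ_k, x_k)‖` satisfies `r_k · c₁ Y_k ≤ r_k ‖ū(τ_k, x_k)‖ + C`, `r_k = cylRadius x_k`,
`ū = poloidalPart u` (`r|u| ≤ r|ū| + |r u_θ|` with the swirl bound).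
[cite: SereginSverak2009, §1 (1.2)] [cite: Palasek2026ElementaryModel, §4] -/
theorem floor_weighted_poloidal (hν : 0 < ν) (h0A : IsAxisymmetric (W.u 0))
    (hfA : ∀ t ∈ Ico 0 W.T, IsAxisymmetric (W.f t)) :
    ∃ C : ℝ, 0 ≤ C ∧ ∀ k : ℕ, ∃ x : EuclideanSpace ℝ (Fin 3), ‖x‖ ≤ W.radius ∧
      W.c₁ * R.Y k ≤ ‖W.u (W.τ k) x‖ ∧
        cylRadius x * (W.c₁ * R.Y k) ≤ cylRadius x * ‖poloidalPart (W.u (W.τ k)) x‖ + C := by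
  obtain ⟨C, hC0, hC⟩ := W.swirl_bounded hν h0A hfA
  refine ⟨C, hC0, fun k => ?_⟩
  obtain ⟨x, hxR, hfloor⟩ := W.floor k
  refine ⟨x, hxR, hfloor, ?_⟩
  have h1 : cylRadius x * (W.c₁ * R.Y k) ≤ cylRadius x * ‖W.u (W.τ k) x‖ :=
    mul_le_mul_of_nonneg_left hfloor (cylRadius_nonneg x)
  have h2 := cylRadius_mul_norm_le_poloidal_add_abs_swirl (W.u (W.τ k)) x
  have h3 := hC (W.τ k) (W.τ_mem k) x
  linarith

/-- **DICHOTOMY AT EVERY LEVEL OF AN AXISYMMETRIC TOWER: the readout point is within `2C/(c₁Y_k)` of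
the axis, or half the floor is poloidal** (`ν > 0`; datum and force axisymmetric; `C` the constant of
`floor_weighted_poloidal`, uniform in `k`): for every `k` the floor's readout point `x_k` has
`r_k · c₁ Y_k ≤ 2C` or `c₁ Y_k / 2 ≤ ‖ū(τ_k, x_k)‖`. Since `Y_k → ∞`, a tower whose level-`k`
structures are read at distance `≫ 1/Y_k` from the axis carries its floors in the poloidal field.
[cite: SereginSverak2009, §1 (1.2)] [cite: Palasek2026ElementaryModel, §4] -/
theorem floor_near_axis_or_poloidal (hν : 0 < ν) (h0A : IsAxisymmetric (W.u 0))
    (hfA : ∀ t ∈ Ico 0 W.T, IsAxisymmetric (W.f t)) :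
    ∃ C : ℝ, 0 ≤ C ∧ ∀ k : ℕ, ∃ x : EuclideanSpace ℝ (Fin 3), ‖x‖ ≤ W.radius ∧
      W.c₁ * R.Y k ≤ ‖W.u (W.τ k) x‖ ∧
        (cylRadius x * (W.c₁ * R.Y k) ≤ 2 * C ∨
          W.c₁ * R.Y k / 2 ≤ ‖poloidalPart (W.u (W.τ k)) x‖) := by
  obtain ⟨C, hC0, hC⟩ := W.floor_weighted_poloidal hν h0A hfA
  refine ⟨C, hC0, fun k => ?_⟩
  obtain ⟨x, hxR, hfloor, hw⟩ := hC k
  refine ⟨x, hxR, hfloor, ?_⟩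
  by_cases h : cylRadius x * (W.c₁ * R.Y k) ≤ 2 * C
  · exact Or.inl h
  · right
    rw [not_le] at h
    have hr0 : 0 ≤ cylRadius x := cylRadius_nonneg x
    have hr : 0 < cylRadius x := by
      rcases hr0.eq_or_lt with h0 | h0
      · rw [← h0, zero_mul] at h; linarith
      · exact h0
    -- `r (c₁Y/2) < r c₁Y - C ≤ r |ū|`
    have h1 : cylRadius x * (W.c₁ * R.Y k / 2) < cylRadius x * ‖poloidalPart (W.u (W.τ k)) x‖ := by
      have e : cylRadius x * (W.c₁ * R.Y k / 2) = cylRadius x * (W.c₁ * R.Y k) / 2 := by ring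
      rw [e]
      linarith
    exact (lt_of_mul_lt_mul_left h1 hr0).le

/-- **The singular slice of an axisymmetric tower realisation lies on the axis** (g7's row on the
interface). [cite: SereginSverak2009, §3 (arXiv p. 9)] -/
theorem singularSlice_subset_axis (hν : 0 < ν) (h0A : IsAxisymmetric (W.u 0))
    (hfA : ∀ t ∈ Ico 0 W.T, IsAxisymmetric (W.f t)) :
    {x₀ : EuclideanSpace ℝ (Fin 3) | ¬ IsBackwardBoundedAt W.u W.T x₀} ⊆
      {x : EuclideanSpace ℝ (Fin 3) | cylRadius x = 0} :=
  W.toDesignedBlowup.singularSlice_subset_axis hν h0A hfA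

/-- **Dissipation concentrates at every singular point of a tower realisation** (g8's row on the
interface; any realisation, axisymmetric or not). [cite: CaffarelliKohnNirenberg1982, Proposition 2] -/
theorem dissipation_concentration (hν : 0 < ν) :
    ∃ ε : ℝ, 0 < ε ∧ ∀ x₀ : EuclideanSpace ℝ (Fin 3), ¬ IsBackwardBoundedAt W.u W.T x₀ →
      ENNReal.ofReal ε <
        limsup (fun r : ℝ => (ENNReal.ofReal r)⁻¹ *
          ∫⁻ w in parabolicCylinder r ((W.T : ℝ), x₀),
            ENNReal.ofReal (frobeniusNormSq (fderiv ℝ (W.u w.1) w.2))) (𝓝[>] (0 : ℝ)) :=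
  W.toDesignedBlowup.dissipation_concentration hν

end PalasekTowerClayBridge.Realisation

end Summit.NavierStokesRegularity.FluidComputer

end
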